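import Literature.NumberTheory.PAdicHodge.LogCyclotomicCupProductNorm
import Literature.NumberTheory.PAdicHodge.PadicFieldSpectralNorm
import HarnessLib

/-!
# Kato II Lemma 1.4.5 in its printed form at a completion: `inv_∞(κ_∞(u) ∪ log χ_cyclo) = −Tr_{K_v/ℚ_p}(log_p u)`,
# and the `F`-linear extension principle `F = ℚ_p · log_p 𝒪_Fˣ`

Topic `Literature/NumberTheory/PAdicHodge`; THEOREMS ONLY (no definition, no named fact, no instance, no `sorry`). Assembly of
`LogCyclotomicCupProductNorm` (`inv_∞(κ_∞(u) ∪ [ψ_log]) = −log_p(N_{K_v/ℚ_p} u)`, σ-free) with `PadicFieldSpectralNorm` (the valuation-side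
`p`-adic field as a normed `ℚ_p`-algebra: `log_p(N_{F/ℚ_p} u) = Tr_{F/ℚ_p}(log_p u)`, `ℚ_p · log_p(𝒪_Fˣ) = F`):

* §1 (any `p`-adic field `F`, valuation side) ★ `PadicField.linearMap_eq_of_eq_on_unitLog` — two `ℚ_p`-linear maps out of `F` that agree on
  `log_p u` for all units `u ∈ 𝒪_Fˣ` are equal (`span_logUnits_eq_top`); ★ `PadicField.eq_neg_trace_of_apply_unitLog` — a `ℚ_p`-linear
  `Λ : F → ℚ_p` with `Λ(log_p u) = −log_p(N_{F/ℚ_p} u)` on units IS `−Tr_{F/ℚ_p}` (`unitLog_norm_eq_trace_unitLog`). This is the formal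
  skeleton of Kato's proof of Lemma 1.4.5 («it suffices to treat `a = log u`; … well known in local class field theory»): the map
  `a ↦ inv δ(a · log χ_cyclo)` is `ℚ_p`-linear, so the unit computation determines it on all of `F`.
* §2 (a completion `K_v`, `v ∣ p`; instances as binders) ★★ `invPadic_cupProduct_kummerPadic_logCyclotomic_eq_neg_trace_unitLog` —
  **`inv_∞(κ_∞(u) ∪ [ψ]) = −Tr_{K_v/ℚ_p}(log_p u)` in `ℚ_p`** for every continuous additive `ℤ_p`-lift `ψ` of `log χ_cyclo` and every unit
  `u ∈ 𝒪_vˣ` (`log_p` on `K_v` = `IUT.LogVolume.unitLog` for `PadicField.normedField`, `Tr` for `LocalField.padicAlgebra`) — Kato's Lemma 1.4.5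
  with `a = log u` verbatim; ★★ `invPadic_twoCocycleClass_eq_neg_trace_unitLog_of_logCyclotomic_presentation` — the same for every `2`-cocycle of
  `ℤ_p(1)` presented through the period line by `τ ↦ ψ(τ) · ℓ_u` (Kato II §1.4.4 `δ[log χ · ℓ_u] = κ_u ∪ log χ`).

Line `kato_lever` of crux K★ `stmt-BirchSwinnertonDyer-22226` (floor (H5) of the K3 / B₂ road, endpoint in the currency `Algebra.trace ℚ_[p] F`
of `EllipticCurves.tatePairingPoint_eq_trace_expStar_log`); what (H4) must still supply is the RECOGNITION of the cochain presenting `η ∪ κ_P` as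
`a · (ψ · ℓ_u)`-type data with `a ∈ F` read off `exp*` and `log_ω` (LEAD lane). BSD / K★ / [REC] are NOT proved by any of this.

## References
* K. Kato, LNM 1553 (1993), Ch. II §1.2.2, §1.4.4, Lemma 1.4.5. [Kato1993LNM1553]
* J. Neukirch, *Algebraic Number Theory* (1999), Ch. II (4.8), (5.5). [NeukirchANT1999]
* J.-P. Serre, *Local Fields* (1979), XIV §1 Prop. 3. [SerreLocalFields1979]
-/

noncomputable section

open Field Function ValuativeRel WittVector NumberField IsDedekindDomain
open scoped NumberField

namespace Literature.NumberTheory.PAdicHodge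

open Literature.NumberTheory.GaloisRepresentations
open Literature.NumberTheory.GaloisRepresentations.IsNonarchimedeanLocalField
open Literature.NumberTheory.GaloisCohomology
open Literature.NumberTheory.EllipticCurves
open Literature.IUT.LogVolume

/-! ## §1 The `F`-linear extension principle -/

namespace PadicField

variable (F : Type) [Field F] [ValuativeRel F] [TopologicalSpace F] [IsNonarchimedeanLocalField F] [CharZero F]
  (p : ℕ) [Fact p.Prime] (hp : valuation F p < 1)

/-- ★ **`ℚ_p`-linear maps out of `F` are determined on `log_p(𝒪_Fˣ)`**: if `f (log_p u) = g (log_p u)` for every unit `u` (`valuation F u = 1`)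
then `f = g` (`F = ℚ_p · log_p 𝒪_Fˣ`, `span_logUnits_eq_top`). [cite: NeukirchANT1999, Ch. II (5.5)] [cite: Kato1993LNM1553, Ch. II Lemma 1.4.5] -/
theorem linearMap_eq_of_eq_on_unitLog {M : Type*} [AddCommGroup M] [Module ℚ_[p] M]
    (f g : letI := LocalField.padicAlgebra F p hp; F →ₗ[ℚ_[p]] M)
    (h : letI := normedField F p hp; ∀ u : F, valuation F u = 1 → f (unitLog u) = g (unitLog u)) : f = g := by
  letI := LocalField.padicAlgebra F p hp
  letI := normedField F p hp
  refine LinearMap.ext_on (span_logUnits_eq_top F p hp) ?_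
  rintro _ ⟨u, hu, rfl⟩
  exact h u ((norm_eq_one_iff F p hp u).1 hu)

/-- ★ **Kato's Lemma 1.4.5, formal skeleton**: a `ℚ_p`-linear `Λ : F → ℚ_p` with `Λ(log_p u) = −log_p(N_{F/ℚ_p} u)` for every unit `u ∈ 𝒪_Fˣ` is
`−Tr_{F/ℚ_p}` (on units `−log_p N u = −Tr log_p u`, `unitLog_norm_eq_trace_unitLog`; then `F = ℚ_p · log_p 𝒪_Fˣ`).
[cite: Kato1993LNM1553, Ch. II Lemma 1.4.5] [cite: NeukirchANT1999, Ch. II (5.5)] -/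
theorem eq_neg_trace_of_apply_unitLog
    (Λ : letI := LocalField.padicAlgebra F p hp; F →ₗ[ℚ_[p]] ℚ_[p])
    (h : letI := LocalField.padicAlgebra F p hp; letI := normedField F p hp
      ∀ u : F, valuation F u = 1 → Λ (unitLog u) = -unitLog (Algebra.norm ℚ_[p] u)) :
    letI := LocalField.padicAlgebra F p hp; Λ = -Algebra.trace ℚ_[p] F := by
  letI := LocalField.padicAlgebra F p hp
  letI := normedField F p hp
  refine linearMap_eq_of_eq_on_unitLog F p hp Λ _ fun u hu => ?_
  rw [h u hu, unitLog_norm_eq_trace_unitLog F p hp hu, LinearMap.neg_apply]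

/-- The same with a scalar: `Λ(log_p u) = c · log_p(N u)` on units forces `Λ = c · Tr`. [cite: Kato1993LNM1553, Ch. II Lemma 1.4.5] -/
theorem eq_smul_trace_of_apply_unitLog (c : ℚ_[p])
    (Λ : letI := LocalField.padicAlgebra F p hp; F →ₗ[ℚ_[p]] ℚ_[p])
    (h : letI := LocalField.padicAlgebra F p hp; letI := normedField F p hp
      ∀ u : F, valuation F u = 1 → Λ (unitLog u) = c * unitLog (Algebra.norm ℚ_[p] u)) :
    letI := LocalField.padicAlgebra F p hp; Λ = c • Algebra.trace ℚ_[p] F := by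
  letI := LocalField.padicAlgebra F p hp
  letI := normedField F p hp
  refine linearMap_eq_of_eq_on_unitLog F p hp Λ _ fun u hu => ?_
  rw [h u hu, unitLog_norm_eq_trace_unitLog F p hp hu, LinearMap.smul_apply, smul_eq_mul]

end PadicField

/-! ## §2 The endpoint at a completion, printed form -/

section Completion

variable {K : Type} [Field K] [NumberField K] {p : ℕ} [Fact p.Prime] (v : HeightOneSpectrum (𝓞 K))
  [CharZero (v.adicCompletion K)] [LocallyCompactSpace (absoluteGaloisGroup (v.adicCompletion K))]

/-- ★★ **Kato II Lemma 1.4.5 at `v ∣ p`, printed form**: for every continuous additive `ℤ_p`-lift `ψ` of `log χ_cyclo` on `Γ_{K_v}` and every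
unit `u ∈ 𝒪_vˣ`, **`inv_∞(κ_∞(u) ∪ [ψ]) = −Tr_{K_v/ℚ_p}(log_p u)` in `ℚ_p`** — `log_p u ∈ K_v` the `p`-adic logarithm (`IUT.LogVolume.unitLog` for
the `ℚ_p`-normalised absolute value `PadicField.normedField`), `Tr` for `LocalField.padicAlgebra`
(`invPadic_cupProduct_kummerPadic_logCyclotomic_eq_neg_unitLog_norm` + `PadicField.unitLog_norm_eq_trace_unitLog`).
[cite: Kato1993LNM1553, Ch. II Lemma 1.4.5] [cite: SerreLocalFields1979, XIV §1 Prop. 3] [cite: NeukirchANT1999, Ch. II (5.5)] -/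
theorem invPadic_cupProduct_kummerPadic_logCyclotomic_eq_neg_trace_unitLog
    (hpv : valuation (v.adicCompletion K) (p : v.adicCompletion K) < 1)
    (ψ : C(absoluteGaloisGroup (v.adicCompletion K), ℤ_[p])) (hψ : ∀ σ τ, ψ (σ * τ) = ψ σ + ψ τ)
    (hψlog : ∀ τ, (ψ τ : ℚ_[p]) = logCyclotomic (F := v.adicCompletion K) p τ)
    (u : v.adicCompletion K) (hu : u ≠ 0) (hu1 : valuation (v.adicCompletion K) u = 1) :
    letI := LocalField.padicAlgebra (v.adicCompletion K) p hpv
    letI := PadicField.normedField (v.adicCompletion K) p hpv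
    ((invPadic (v.adicCompletion K) p ((twistPairingPadic (v.adicCompletion K) p).cupProduct
        (kummerPadic (v.adicCompletion K) p u hu)
        (oneCocycleClass _ (homOneCocycle (v.adicCompletion K) p ψ hψ))) : ℤ_[p]) : ℚ_[p]) =
      -Algebra.trace ℚ_[p] (v.adicCompletion K) (unitLog u) := by
  rw [invPadic_cupProduct_kummerPadic_logCyclotomic_eq_neg_unitLog_norm v hpv ψ hψ hψlog u hu hu1,
    PadicField.unitLog_norm_eq_trace_unitLog (v.adicCompletion K) p hpv hu1]

variable [Fact (¬ IsUnit (p : integerC (v.adicCompletion K)))]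
  [IsAdicComplete (Ideal.span {(p : integerC (v.adicCompletion K))}) (integerC (v.adicCompletion K))]

/-- ★★ **Kato II §1.4.4 + Lemma 1.4.5 on cochains, printed form**: for every continuous additive `ℤ_p`-lift `ψ` of `log χ_cyclo`, every unit
`u ∈ 𝒪_vˣ` and EVERY continuous `2`-cocycle `c` of `ℤ_p(1)(K̄_v)` presented through the period line `ι : ℤ_p(1) → B_dR⁺(K_v)` by the cochain
`τ ↦ ψ(τ) · ℓ_u`: **`inv_∞[c] = −Tr_{K_v/ℚ_p}(log_p u)` in `ℚ_p`**. [cite: Kato1993LNM1553, Ch. II §1.4.4 and Lemma 1.4.5]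
[cite: NeukirchANT1999, Ch. II (5.5)] -/
theorem invPadic_twoCocycleClass_eq_neg_trace_unitLog_of_logCyclotomic_presentation
    (hpv : valuation (v.adicCompletion K) (p : v.adicCompletion K) < 1)
    (hF : Function.Surjective (fontaineTheta (integerC (v.adicCompletion K)) p))
    (ψ : C(absoluteGaloisGroup (v.adicCompletion K), ℤ_[p])) (hψ : ∀ σ τ, ψ (σ * τ) = ψ σ + ψ τ)
    (hψlog : ∀ τ, (ψ τ : ℚ_[p]) = logCyclotomic (F := v.adicCompletion K) p τ)
    (u : v.adicCompletion K) (hu : u ≠ 0) (hu1 : valuation (v.adicCompletion K) u = 1)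
    {c : contTwoCocycles (tateModuleMuPadic (v.adicCompletion K) p).toTopRep}
    (hc : IsCoboundaryLift (ρ := tateModuleMuPadic (v.adicCompletion K) p) (BdRPlusTop.galRepr (v.adicCompletion K) p)
      (BdRPlusTop.periodLine (v.adicCompletion K) p)
      (fun τ => BdRPlusTop.of (v.adicCompletion K) p (qpToBdR ((ψ τ : ℤ_[p]) : ℚ_[p])) *
        BdRPlusTop.unitKummerLog hpv hF hu (norm_algebraMap_normedAlgClosure_le_one_of_valuation_le_one hu1.le)) c) :
    letI := LocalField.padicAlgebra (v.adicCompletion K) p hpv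
    letI := PadicField.normedField (v.adicCompletion K) p hpv
    ((invPadic (v.adicCompletion K) p (twoCocycleClass _ c) : ℤ_[p]) : ℚ_[p]) =
      -Algebra.trace ℚ_[p] (v.adicCompletion K) (unitLog u) := by
  rw [invPadic_twoCocycleClass_eq_neg_unitLog_norm_of_logCyclotomic_presentation v hpv hF ψ hψ hψlog u hu hu1 hc,
    PadicField.unitLog_norm_eq_trace_unitLog (v.adicCompletion K) p hpv hu1]

end Completion

end Literature.NumberTheory.PAdicHodge

end
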